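import Literature.Probability.Percolation.FourFunctionsBernoulliInfinite
import Literature.Probability.Percolation.PositiveAssociationIntegral
import Summits.CriticalPhenomena.PercolationContinuityZ3.Theorems.SahiBoxTP2SetConfigurations

/-!
# FKG-lattice Gibbs modifications of Bernoulli percolation by MEASURABLE weights: box-TP₂, FKG, Sahi positivity given `C_n`
# (cell `prim-sahi`, typer seat, generation 20; `--supports stmt-CriticalPhenomena-4575`)

Theorems only (no definitions, no named facts, no sorries).

The four functions theorem for `prodBernoulli p` / bond percolation `P_p` on ARBITRARY index sets (Batty–Bollmann 1980,
Cor. 3.9; tree `Literature.Probability.Percolation.prodBernoulli_lintegral_four_functions`,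
`mIsSetTP2_withDensity_prodBernoulli`, `isPositivelyAssociated_withDensity_prodBernoulli`) makes every Gibbs
modification `ρ · P_p` by a MEASURABLE weight with the FKG lattice condition `ρ(a) ρ(b) ≤ ρ(a ∩ b) ρ(a ∪ b)` at every
pair set-TP₂.  This file feeds that into the cell's `Set ι` machinery (`SahiBoxTP2SetConfigurations.lean`):

* `isBoxTP2_of_mIsSetTP2_set` — on `Set ι`, `ι` countable (order intervals `{x | s ⊆ x ⊆ t}` are measurable),
  set-TP₂ ⟹ box-TP₂ (`IsBoxTP2`).
* `isBoxTP2_withDensity_prodBernoulli`, `isBoxTP2_prodBernoulli`, `isBoxTP2_withDensity_bondPercolation` — box-TP₂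
  of the tilts (and of `prodBernoulli p`, `P_p` themselves) for countable `ι` / countable edge types.
* `msahiE_nonneg_withDensity_prodBernoulli_of_sahiConjecture` (+ `bondPercolation`) — **given Sahi's `C_n`, every
  normalised measurable FKG-lattice tilt of `prodBernoulli p` (`ι ≃ ℕ`) is Sahi-positive of order `n`** for all
  measurable nonnegative `⊆`-monotone functionals (generation 16 treated the random-cluster weights `q^{k(ω)}` in
  finite volume and their limits; here the weight is an arbitrary measurable lattice-condition function in infinite
  volume).
* UNCONDITIONALLY `integral_mul_integral_le_withDensity_prodBernoulli` (+ `bondPercolation`) — the FKG covariance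
  inequality for bounded measurable increasing functionals under the normalised tilt, ANY index set (positive
  association, tree `IsPositivelyAssociated.integral_mul_integral_le_integral_mul`).

HONEST FRAMING (cell rule): nothing here proves `C_n`; the order-`n` statements carry `SahiConjecture n` as a
hypothesis.
-/

noncomputable section

namespace Summit.CriticalPhenomena.PercolationContinuityZ3.Theorems.SahiBoxTP2

open MeasureTheory Measure Set Function Literature.Combinatorics.Sahi2008 Literature.Probability.Percolation
open Literature.Probability.LatticeModels Literature.Probability.LatticeModels.Affiliation ProbabilityTheory
open scoped ENNReal SetFamily unitInterval

variable {ι : Type*}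

/-! ### Set-TP₂ ⟹ box-TP₂ for laws of random subsets of a countable set -/

/-- Order intervals `{x | s ⊆ x ⊆ t}` of `Set ι` are measurable when `ι` is countable (private copy of the cell's
`SahiRandomClusterLimits.measurableSet_Icc_set`, to keep the random-cluster files out of the import closure). [folklore] -/
private theorem measurableSet_setIcc [Countable ι] (s t : Set ι) : MeasurableSet (Icc s t) := by
  have e : Icc s t = ⋂ i, ({x : Set ι | i ∈ s → i ∈ x} ∩ {x : Set ι | i ∈ x → i ∈ t}) := by
    ext x
    simp only [mem_Icc, subset_def, mem_iInter, mem_inter_iff, mem_setOf_eq]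
    exact ⟨fun h i => ⟨fun hi => h.1 i hi, fun hi => h.2 i hi⟩, fun h => ⟨fun i hi => (h i).1 hi, fun i hi => (h i).2 hi⟩⟩
  rw [e]
  have hm : ∀ i : ι, MeasurableSet {x : Set ι | i ∈ x} := fun i => measurableSet_setOf.2 (measurable_set_mem i)
  refine MeasurableSet.iInter fun i => MeasurableSet.inter ?_ ?_
  · by_cases hi : i ∈ s
    · have h' : {x : Set ι | i ∈ s → i ∈ x} = {x | i ∈ x} := by ext x; simp [hi]
      rw [h']; exact hm i
    · have h' : {x : Set ι | i ∈ s → i ∈ x} = univ := by ext x; simp [hi]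
      rw [h']; exact MeasurableSet.univ
  · by_cases hi : i ∈ t
    · have h' : {x : Set ι | i ∈ x → i ∈ t} = univ := by ext x; simp [hi]
      rw [h']; exact MeasurableSet.univ
    · have h' : {x : Set ι | i ∈ x → i ∈ t} = {x | i ∈ x}ᶜ := by ext x; simp [hi]
      rw [h']; exact (hm i).compl

/-- **Set-TP₂ ⟹ box-TP₂ for a law on `Set ι`, `ι` countable** (`[s,t] ⊼ [s',t'] ⊆ [s ∩ s', t ∩ t']`,
`[s,t] ⊻ [s',t'] ⊆ [s ∪ s', t ∪ t']`). [folklore] -/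
theorem isBoxTP2_of_mIsSetTP2_set [Countable ι] {μ : Measure (Set ι)} (h : mIsSetTP2 μ) : IsBoxTP2 μ := by
  intro a b a' b'
  have h1 : Icc a b ⊼ Icc a' b' ⊆ Icc (a ⊓ a') (b ⊓ b') :=
    Set.infs_subset_iff.2 fun x hx y hy => ⟨inf_le_inf hx.1 hy.1, inf_le_inf hx.2 hy.2⟩
  have h2 : Icc a b ⊻ Icc a' b' ⊆ Icc (a ⊔ a') (b ⊔ b') :=
    Set.sups_subset_iff.2 fun x hx y hy => ⟨sup_le_sup hx.1 hy.1, sup_le_sup hx.2 hy.2⟩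
  exact (h (measurableSet_setIcc a b) (measurableSet_setIcc a' b')).trans
    (mul_le_mul' (measure_mono h1) (measure_mono h2))

/-! ### Box-TP₂ of measurable FKG-lattice tilts of product Bernoulli measures -/

/-- **Measurable FKG-lattice tilts of `prodBernoulli p` are box-TP₂** (`ι` countable): for every measurable
`ρ : Set ι → [0,∞]` with `ρ(a) ρ(b) ≤ ρ(a ∩ b) ρ(a ∪ b)` at every pair. [this work] -/
theorem isBoxTP2_withDensity_prodBernoulli [Countable ι] (p : ι → unitInterval) (ρ : Set ι → ℝ≥0∞) (hρ : Measurable ρ)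
    (hL : ∀ a b, ρ a * ρ b ≤ ρ (a ∩ b) * ρ (a ∪ b)) : IsBoxTP2 ((prodBernoulli p).withDensity ρ) :=
  isBoxTP2_of_mIsSetTP2_set (mIsSetTP2_withDensity_prodBernoulli p ρ hρ hL)

/-- **`prodBernoulli p` is box-TP₂ on `Set ι`**, `ι` countable, any parameters. [this work] -/
theorem isBoxTP2_prodBernoulli [Countable ι] (p : ι → unitInterval) : IsBoxTP2 (prodBernoulli p) :=
  isBoxTP2_of_mIsSetTP2_set (mIsSetTP2_prodBernoulli p)

/-- **Measurable FKG-lattice tilts of bond percolation `P_p` are box-TP₂** (countable edge type, any graph). [this work] -/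
theorem isBoxTP2_withDensity_bondPercolation {V : Type*} [Countable V] (G : SimpleGraph V) (p : unitInterval)
    (ρ : BondConfig V → ℝ≥0∞) (hρ : Measurable ρ) (hL : ∀ a b, ρ a * ρ b ≤ ρ (a ∩ b) * ρ (a ∪ b)) :
    IsBoxTP2 ((bondPercolation G p).withDensity ρ) :=
  isBoxTP2_of_mIsSetTP2_set (mIsSetTP2_withDensity_bondPercolation G p ρ hρ hL)

/-! ### Sahi positivity given `C_n`; FKG unconditionally -/

/-- A weight of total mass one defines a probability measure. [folklore] -/
private theorem isProbabilityMeasure_withDensity_of_lintegral_eq_one {α : Type*} [MeasurableSpace α] (μ : Measure α)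
    {ρ : α → ℝ≥0∞} (h1 : ∫⁻ x, ρ x ∂μ = 1) : IsProbabilityMeasure (μ.withDensity ρ) :=
  ⟨by rw [withDensity_apply _ MeasurableSet.univ, Measure.restrict_univ, h1]⟩

/-- **Given Sahi's `C_n`: every normalised measurable FKG-lattice tilt of `prodBernoulli p` (`ι ≃ ℕ`) is
Sahi-positive of order `n`** — `E_n(f_0,…,f_{n−1}) ≥ 0` for all measurable nonnegative `⊆`-monotone functionals.
HONEST FRAMING: `SahiConjecture n` is a hypothesis. [this work; cite: Sahi2008, Conj. 5 (p. 212); LiebSahi2021, Conj. 1.1] -/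
theorem msahiE_nonneg_withDensity_prodBernoulli_of_sahiConjecture {n : ℕ} (e : ι ≃ ℕ) (hC : SahiConjecture n)
    (p : ι → unitInterval) (ρ : Set ι → ℝ≥0∞) (hρ : Measurable ρ) (hL : ∀ a b, ρ a * ρ b ≤ ρ (a ∩ b) * ρ (a ∪ b))
    (h1 : ∫⁻ a, ρ a ∂prodBernoulli p = 1) (f : Fin n → Set ι → ℝ) (hfm : ∀ i, Measurable (f i))
    (hf0 : ∀ i x, 0 ≤ f i x) (hmono : ∀ i, Monotone (f i)) : 0 ≤ msahiE ((prodBernoulli p).withDensity ρ) n f := by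
  haveI : Countable ι := Countable.of_equiv ℕ e.symm
  haveI := isProbabilityMeasure_withDensity_of_lintegral_eq_one (prodBernoulli p) h1
  exact msahiE_nonneg_of_isBoxTP2_set e ((sahiConjecture_iff_forall_liebSahiContinuum n).1 hC) _
    (isBoxTP2_withDensity_prodBernoulli p ρ hρ hL) f hfm hf0 hmono

/-- Decreasing (`⊇`-monotone) functionals. [this work] -/
theorem msahiE_nonneg_withDensity_prodBernoulli_of_sahiConjecture_antitone {n : ℕ} (e : ι ≃ ℕ)
    (hC : SahiConjecture n) (p : ι → unitInterval) (ρ : Set ι → ℝ≥0∞) (hρ : Measurable ρ)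
    (hL : ∀ a b, ρ a * ρ b ≤ ρ (a ∩ b) * ρ (a ∪ b)) (h1 : ∫⁻ a, ρ a ∂prodBernoulli p = 1)
    (f : Fin n → Set ι → ℝ) (hfm : ∀ i, Measurable (f i)) (hf0 : ∀ i x, 0 ≤ f i x) (hanti : ∀ i, Antitone (f i)) :
    0 ≤ msahiE ((prodBernoulli p).withDensity ρ) n f := by
  haveI : Countable ι := Countable.of_equiv ℕ e.symm
  haveI := isProbabilityMeasure_withDensity_of_lintegral_eq_one (prodBernoulli p) h1
  exact msahiE_nonneg_of_isBoxTP2_set_antitone e ((sahiConjecture_iff_forall_liebSahiContinuum n).1 hC) _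
    (isBoxTP2_withDensity_prodBernoulli p ρ hρ hL) f hfm hf0 hanti

/-- **Given `C_n`: normalised measurable FKG-lattice tilts of bond percolation `P_p` (countable edge type `Sym2 V ≃ ℕ`)
are Sahi-positive of order `n`** for measurable nonnegative increasing functionals.  HONEST FRAMING: `SahiConjecture n`
is a hypothesis. [this work; cite: Sahi2008, Conj. 5 (p. 212); LiebSahi2021, Conj. 1.1] -/
theorem msahiE_nonneg_withDensity_bondPercolation_of_sahiConjecture {n : ℕ} {V : Type*} [Countable V] (e : Sym2 V ≃ ℕ)
    (hC : SahiConjecture n) (G : SimpleGraph V) (p : unitInterval) (ρ : BondConfig V → ℝ≥0∞) (hρ : Measurable ρ)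
    (hL : ∀ a b, ρ a * ρ b ≤ ρ (a ∩ b) * ρ (a ∪ b)) (h1 : ∫⁻ a, ρ a ∂bondPercolation G p = 1)
    (f : Fin n → BondConfig V → ℝ) (hfm : ∀ i, Measurable (f i)) (hf0 : ∀ i x, 0 ≤ f i x)
    (hmono : ∀ i, Monotone (f i)) : 0 ≤ msahiE ((bondPercolation G p).withDensity ρ) n f := by
  haveI := isProbabilityMeasure_withDensity_of_lintegral_eq_one (bondPercolation G p) h1
  exact msahiE_nonneg_of_isBoxTP2_set e ((sahiConjecture_iff_forall_liebSahiContinuum n).1 hC) _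
    (isBoxTP2_withDensity_bondPercolation G p ρ hρ hL) f hfm hf0 hmono

/-- **Unconditionally: the FKG covariance inequality for normalised measurable FKG-lattice tilts of `prodBernoulli p`,
ANY index set** — `∫ f ∫ g ≤ ∫ f g` for bounded measurable `⊆`-monotone `f, g` (positive association of the tilt,
`isPositivelyAssociated_withDensity_prodBernoulli`, and the tree's covariance form). [this work] -/
theorem integral_mul_integral_le_withDensity_prodBernoulli (p : ι → unitInterval) (ρ : Set ι → ℝ≥0∞)
    (hρ : Measurable ρ) (hL : ∀ a b, ρ a * ρ b ≤ ρ (a ∩ b) * ρ (a ∪ b)) (h1 : ∫⁻ a, ρ a ∂prodBernoulli p = 1)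
    {f g : Set ι → ℝ} (hf : Monotone f) (hg : Monotone g) (hfm : Measurable f) (hgm : Measurable g)
    (hfb : ∃ C, ∀ x, |f x| ≤ C) (hgb : ∃ C, ∀ x, |g x| ≤ C) :
    (∫ x, f x ∂(prodBernoulli p).withDensity ρ) * (∫ x, g x ∂(prodBernoulli p).withDensity ρ) ≤
      ∫ x, f x * g x ∂(prodBernoulli p).withDensity ρ := by
  haveI := isProbabilityMeasure_withDensity_of_lintegral_eq_one (prodBernoulli p) h1
  exact (isPositivelyAssociated_withDensity_prodBernoulli p ρ hρ hL h1).integral_mul_integral_le_integral_mul hf hg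
    hfm hgm hfb hgb

/-- **Unconditionally: the FKG covariance inequality for normalised measurable FKG-lattice tilts of `P_p` on ANY graph.**
[this work] -/
theorem integral_mul_integral_le_withDensity_bondPercolation {V : Type*} (G : SimpleGraph V) (p : unitInterval)
    (ρ : BondConfig V → ℝ≥0∞) (hρ : Measurable ρ) (hL : ∀ a b, ρ a * ρ b ≤ ρ (a ∩ b) * ρ (a ∪ b))
    (h1 : ∫⁻ a, ρ a ∂bondPercolation G p = 1) {f g : BondConfig V → ℝ} (hf : Monotone f) (hg : Monotone g)
    (hfm : Measurable f) (hgm : Measurable g) (hfb : ∃ C, ∀ x, |f x| ≤ C) (hgb : ∃ C, ∀ x, |g x| ≤ C) :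
    (∫ x, f x ∂(bondPercolation G p).withDensity ρ) * (∫ x, g x ∂(bondPercolation G p).withDensity ρ) ≤
      ∫ x, f x * g x ∂(bondPercolation G p).withDensity ρ := by
  haveI := isProbabilityMeasure_withDensity_of_lintegral_eq_one (bondPercolation G p) h1
  exact (isPositivelyAssociated_withDensity_bondPercolation G p ρ hρ hL h1).integral_mul_integral_le_integral_mul hf hg
    hfm hgm hfb hgb

end Summit.CriticalPhenomena.PercolationContinuityZ3.Theorems.SahiBoxTP2
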